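import Summits.AnomalousDissipation.AnomalousDissipation.Theorems.MarginalStabilityChainStrainedLayerLawClockLaminar
import Summits.AnomalousDissipation.AnomalousDissipation.Theorems.MarginalStabilityChainStrainedLayerLawParallelRelax
import HarnessLib

/-!
# Crux `MarginalStabilityChain.StrainedLayerLaw` (stmt-AnomalousDissipation-3007), line `FirstLemmasR2K4`:
# the PARALLEL MEMBER has SHEAR-LAYER TAILS (registered sub-goal `hasShearLayerTails_parallelMember`)

Support file (`--supports stmt-AnomalousDissipation-3007`; registered sub-goal `hasShearLayerTails_parallelMember`,
wave 1 of line lead c6, `prover-line-stmt-AnomalousDissipation-3007-c6-0`, 2026-08-16).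

For `ν > 0` and `g ∈ C²_c(ℝ)` the parallel member of the crux's class (`…ParallelRelaxMember.lean`,
`inCruxClass_parallel`) is `u(t, x, y) = U_B^ν(y) + P(t, y)`, `v = 0`, with `U_B^ν = burgersLayerProfile 1 ν 1` the
Burgers layer and `P(t, y) = ∫ G₁(z) g(eᵗy − √s(t) z) dz` the strained shear diffusion, which for `t > 0` is the caloric
extension `heatExtension g (s t) (eᵗ y)`, `s(t) = ν(e^{2t} − 1)/2` (`sdiff_eq_heatExtension`). This file proves that
this member satisfies the repaired side condition `HasShearLayerTails u 0` (`Literature/Analysis/FluidPDE/StretchedLayerShearTails.lean`)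
GIVEN, as an explicit hypothesis, the strained-caloric tail estimate (registered neighbour `stub_strainedCaloricTails`):
on every compact time range `[a, b] ⊂ (0, ∞)` the function `P`, its `y`-, `yy`- and `t`-derivatives are bounded by one
`C e^{−k|y|}`.

Proof (model: the laminar case `hasShearLayerTails_burgersShearLayer`, Literature `StretchedLayerNSBurgersTails.lean`):
`v = 0` and all `x`-slice derivatives of `u` vanish (`deriv_const`); clause (i) (`t ∈ (0, T]`, down to `t = 0⁺`) only needs
BOUNDEDNESS of `P` and `P_y`, which is the maximum principle `|e^{σΔ}h| ≤ sup|h|` (`norm_heatExtension_le`) for `h = g`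
and `h = g′` (`(e^{σΔ}g)′ = e^{σΔ}(g′)`, `deriv_heatExtension_of_hasCompactSupport_line`); clause (ii) (`t ∈ [δ, T]`)
combines the hypothesis on `[δ, max δ T]` with the Gaussian tails of `U_B`, `U_B′`, `U_B″` and of `U_B² − ¼`
(`abs_burgersLayerProfile_sq_sub_le`, `burgersLayerProfileD_le_exp`, `abs_burgersLayerProfileDD_le_exp`), using
`(U_B + P)² − ¼ = (U_B² − ¼) + P(2U_B + P)`; the final rate is `min κ k`, `κ = burgersLayerRate 1 ν`.

No facts are asserted; no definitions (file-local notation `sdiff[ν, g, t, y]` abbreviates the explicit formula).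
References: Majda–Bertozzi 2002 §1.4 (1.34), §3.1.3; the tree files named above.
-/

set_option linter.dupNamespace false

noncomputable section

open scoped Topology ENNReal
open Filter Set Function MeasureTheory

namespace Summit.AnomalousDissipation.AnomalousDissipation.Theorems.StrainedLayerLaw.LogEnstrophyClock

open Literature.Analysis.FluidPDE Literature.Analysis.FluidPDE.StretchedLayer
open Literature.Analysis.UnboundedOperators
open Summit.AnomalousDissipation.AnomalousDissipation.Theses.MarginalStabilityChain
open Summit.AnomalousDissipation.AnomalousDissipation.Theorems.StrainedLayerLaw.StrainWorkSumRule
open Summit.AnomalousDissipation.AnomalousDissipation.Theorems.StrainedLayerLaw.ParallelRelax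

/-! File-local NOTATION (no definitions; as in `…ParallelRelaxMember.lean`):
`sdiff[ν, g, t, y] = ∫ G₁(z) g(eᵗy − √(ν(e^{2t} − 1)/2)·z) dz`, the strained shear diffusion of the datum `g`. -/
local notation3 (prettyPrint := false) "sdiff[" ν ", " g ", " t ", " y "]" =>
  ∫ z, heatKernel 1 z * g (Real.exp t * y - Real.sqrt (ν * (Real.exp (2 * t) - 1) / 2) * z)

/-! ### Derivative bookkeeping for the member `U_B + P` -/

section ParallelShearTails

variable {ν : ℝ} {g : ℝ → ℝ}

/-- First `y`-slice derivative of the member for `t > 0`: `∂_y(U_B + P) = U_B′ + ∂_yP`. [folklore] -/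
theorem parallelShearTails_deriv_slice (hν : 0 < ν) (hg : ContDiff ℝ 2 g) (hc : HasCompactSupport g)
    {t : ℝ} (ht : 0 < t) (y : ℝ) :
    deriv (fun s => burgersLayerProfile 1 ν 1 s + sdiff[ν, g, t, s]) y =
      burgersLayerProfileD 1 ν 1 y + deriv (fun s => sdiff[ν, g, t, s]) y := by
  have hPd : Differentiable ℝ (fun s => sdiff[ν, g, t, s]) :=
    (contDiff_sdiff_slice hν hg hc ht).differentiable (by norm_num)
  exact ((hasDerivAt_burgersLayerProfile' 1 ν 1 y).add (hPd y).hasDerivAt).deriv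

/-- First `y`-slice derivative of the member for `t > 0`, caloric form:
`∂_y(U_B + P)(t, y) = U_B′(y) + d/dy [(e^{s(t)Δ}g)(eᵗy)]`. [folklore] -/
theorem parallelShearTails_deriv_slice_caloric (hν : 0 < ν) (hg : ContDiff ℝ 2 g) (hc : HasCompactSupport g)
    {t : ℝ} (ht : 0 < t) (y : ℝ) :
    deriv (fun s => burgersLayerProfile 1 ν 1 s + sdiff[ν, g, t, s]) y =
      burgersLayerProfileD 1 ν 1 y +
        deriv (fun s => heatExtension g (ν * (Real.exp (2 * t) - 1) / 2) (Real.exp t * s)) y := by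
  rw [parallelShearTails_deriv_slice hν hg hc ht y, sdiff_slice_eq hν ht]

/-- Second `y`-slice derivative of the member for `t > 0`, caloric form:
`∂_y∂_y(U_B + P)(t, y) = U_B″(y) + d²/dy² [(e^{s(t)Δ}g)(eᵗy)]`. [folklore] -/
theorem parallelShearTails_deriv_deriv_slice (hν : 0 < ν) (hg : ContDiff ℝ 2 g) (hc : HasCompactSupport g)
    {t : ℝ} (ht : 0 < t) (y : ℝ) :
    deriv (fun s => deriv (fun r => burgersLayerProfile 1 ν 1 r + sdiff[ν, g, t, r]) s) y =
      burgersLayerProfileDD 1 ν 1 y +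
        deriv (fun s => deriv (fun r => heatExtension g (ν * (Real.exp (2 * t) - 1) / 2) (Real.exp t * r)) s)
          y := by
  set σ : ℝ := ν * (Real.exp (2 * t) - 1) / 2 with hσ
  have hF : deriv (fun r => burgersLayerProfile 1 ν 1 r + sdiff[ν, g, t, r]) =
      fun s => burgersLayerProfileD 1 ν 1 s + Real.exp t * deriv (heatExtension g σ) (Real.exp t * s) :=
    deriv_member_slice hν hg hc ht
  have hG : (fun s => deriv (fun r => heatExtension g σ (Real.exp t * r)) s) =
      fun s => Real.exp t * deriv (heatExtension g σ) (Real.exp t * s) :=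
    funext fun s => deriv_comp_const_mul _ _ _
  have hE2 : Differentiable ℝ (deriv (heatExtension g σ)) :=
    (contDiff_heatExtension_of_hasCompactSupport hg hc σ).differentiable_deriv_two
  have hd : Differentiable ℝ (fun s => Real.exp t * deriv (heatExtension g σ) (Real.exp t * s)) :=
    (hE2.comp (differentiable_id.const_mul (Real.exp t))).const_mul (Real.exp t)
  change deriv (deriv (fun r => burgersLayerProfile 1 ν 1 r + sdiff[ν, g, t, r])) y = _
  rw [hF, hG]
  exact ((hasDerivAt_burgersLayerProfileD 1 ν 1 y).add (hd y).hasDerivAt).deriv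

/-- Time derivative of the member for `t > 0`, caloric form: `∂ₜ(U_B(y) + P(t, y)) = d/dt [(e^{s(t)Δ}g)(eᵗy)]`
(the two time slices agree on the open set `(0, ∞)`). [folklore] -/
theorem parallelShearTails_deriv_time (hν : 0 < ν) {t : ℝ} (ht : 0 < t) (y : ℝ) :
    deriv (fun τ => burgersLayerProfile 1 ν 1 y + sdiff[ν, g, τ, y]) t =
      deriv (fun τ => heatExtension g (ν * (Real.exp (2 * τ) - 1) / 2) (Real.exp τ * y)) t := by
  rw [deriv_const_add]
  have hev : (fun τ => sdiff[ν, g, τ, y]) =ᶠ[𝓝 t]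
      fun τ => heatExtension g (ν * (Real.exp (2 * τ) - 1) / 2) (Real.exp τ * y) := by
    filter_upwards [isOpen_Ioi.mem_nhds ht] with τ hτ
    exact sdiff_eq_heatExtension hν g hτ y
  exact hev.deriv_eq

/-! ### Clause (i): boundedness of `P` and `∂_yP` down to `t = 0⁺` (maximum principle) -/

/-- Sup bounds of the strained shear diffusion and of its `y`-derivative on `(0, T]`: `|P| ≤ sup|g|` and
`|∂_yP| = eᵗ|(e^{s(t)Δ}g′)(eᵗy)| ≤ e^T sup|g′|` (maximum principle for the caloric extension). [folklore] -/
theorem parallelShearTails_sup (hν : 0 < ν) (hg : ContDiff ℝ 2 g) (hc : HasCompactSupport g) (T : ℝ) :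
    ∃ C : ℝ, 0 ≤ C ∧ ∀ t ∈ Set.Ioc 0 T, ∀ y : ℝ,
      |sdiff[ν, g, t, y]| ≤ C ∧ |deriv (fun s => sdiff[ν, g, t, s]) y| ≤ C := by
  obtain ⟨A, hA⟩ := hg.continuous.bounded_above_of_compact_support hc
  obtain ⟨B, hB⟩ := (hg.continuous_deriv (by norm_num)).bounded_above_of_compact_support hc.deriv
  have hA0 : 0 ≤ A := (norm_nonneg _).trans (hA 0)
  have hB0 : 0 ≤ B := (norm_nonneg _).trans (hB 0)
  refine ⟨A + Real.exp T * B, by positivity, fun t ht y => ?_⟩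
  have ht0 : 0 < t := ht.1
  have hσ := sclock_pos hν ht0
  have h1 : |sdiff[ν, g, t, y]| ≤ A := by
    rw [sdiff_eq_heatExtension hν g ht0 y]
    have := norm_heatExtension_le hA hσ (Real.exp t * y)
    rwa [Real.norm_eq_abs] at this
  have h2 : |deriv (fun s => sdiff[ν, g, t, s]) y| ≤ Real.exp T * B := by
    rw [deriv_sdiff_slice hν ht0 y, deriv_heatExtension_of_hasCompactSupport_line (hg.of_le (by norm_num)) hc,
      abs_mul, abs_of_pos (Real.exp_pos t)]
    have := norm_heatExtension_le hB hσ (Real.exp t * y)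
    rw [Real.norm_eq_abs] at this
    exact mul_le_mul (Real.exp_le_exp.2 ht.2) this (abs_nonneg _) (Real.exp_pos T).le
  exact ⟨h1.trans (le_add_of_nonneg_right (by positivity)), h2.trans (le_add_of_nonneg_left hA0)⟩

/-! ### Clause (ii): exponential tails on `[δ, T]` -/

/-- The real-variable bookkeeping of clause (ii): if `|U| ≤ ½`, `|U² − ¼|, |U₁|, |U₂| ≤ Aᵢ E₁` and
`|p|, |p₁|, |p₂|, |p_t| ≤ C E₂` with `E₁, E₂ ≤ E`, `E₂ ≤ 1`, then
`|(U + p)² − ¼| + |U₁ + p₁| + |U₂ + p₂| + |p_t| ≤ (A₁ + A₂ + A₃ + C(C + 4)) E`. [folklore] -/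
theorem parallelShearTails_algebra {U U₁ U₂ p p₁ p₂ q A₁ A₂ A₃ C E₁ E₂ E : ℝ}
    (hA₁ : 0 ≤ A₁) (hA₂ : 0 ≤ A₂) (hA₃ : 0 ≤ A₃) (hC : 0 ≤ C) (hE₁ : E₁ ≤ E) (hE₂ : E₂ ≤ E)
    (hE₂0 : 0 ≤ E₂) (hE₂1 : E₂ ≤ 1)
    (hU : |U| ≤ 1 / 2) (h0 : |U ^ 2 - 1 / 4| ≤ A₁ * E₁) (h1 : |U₁| ≤ A₂ * E₁) (h2 : |U₂| ≤ A₃ * E₁)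
    (hp : |p| ≤ C * E₂) (hp1 : |p₁| ≤ C * E₂) (hp2 : |p₂| ≤ C * E₂) (hq : |q| ≤ C * E₂) :
    |(U + p) ^ 2 - 1 / 4| + |U₁ + p₁| + |U₂ + p₂| + |q| ≤ (A₁ + A₂ + A₃ + C * (C + 4)) * E := by
  have hpC : |p| ≤ C := hp.trans (by nlinarith)
  have hsq : |(U + p) ^ 2 - 1 / 4| ≤ A₁ * E₁ + C * E₂ * (1 + C) := by
    have hid : (U + p) ^ 2 - 1 / 4 = (U ^ 2 - 1 / 4) + p * (2 * U + p) := by ring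
    rw [hid]
    refine (abs_add_le _ _).trans (add_le_add h0 ?_)
    rw [abs_mul]
    have h2U : |2 * U + p| ≤ 1 + C := by
      refine (abs_add_le _ _).trans ?_
      rw [abs_mul, abs_two]
      linarith
    exact mul_le_mul hp h2U (abs_nonneg _) (by positivity)
  have hs1 : |U₁ + p₁| ≤ A₂ * E₁ + C * E₂ := (abs_add_le _ _).trans (add_le_add h1 hp1)
  have hs2 : |U₂ + p₂| ≤ A₃ * E₁ + C * E₂ := (abs_add_le _ _).trans (add_le_add h2 hp2)
  have hm1 : (A₁ + A₂ + A₃) * E₁ ≤ (A₁ + A₂ + A₃) * E := mul_le_mul_of_nonneg_left hE₁ (by positivity)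
  have hm2 : C * (C + 4) * E₂ ≤ C * (C + 4) * E := mul_le_mul_of_nonneg_left hE₂ (by positivity)
  nlinarith

/-- Clause (ii) for the member, from the strained-caloric tail estimate `hH` of the datum `g` (the statement of the
registered neighbour `stub_strainedCaloricTails` at `ν, g`): on `[δ, T]` the shear quantity `(U_B + P)² − ¼`, the
first and second `y`-slice derivatives and the time derivative of `U_B + P` are bounded by one `C′ e^{−k′|y|}`,
`k′ = min κ k`. [folklore] -/
theorem parallelShearTails_clauseII
    (hH : ∀ a b : ℝ, 0 < a → a ≤ b → ∃ C k : ℝ, 0 < k ∧ ∀ t ∈ Set.Icc a b, ∀ y : ℝ,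
        |heatExtension g (ν * (Real.exp (2 * t) - 1) / 2) (Real.exp t * y)| ≤ C * Real.exp (-k * |y|) ∧
        |deriv (fun s => heatExtension g (ν * (Real.exp (2 * t) - 1) / 2) (Real.exp t * s)) y| ≤
          C * Real.exp (-k * |y|) ∧
        |deriv (fun s => deriv (fun r => heatExtension g (ν * (Real.exp (2 * t) - 1) / 2) (Real.exp t * r)) s) y| ≤
          C * Real.exp (-k * |y|) ∧
        |deriv (fun τ => heatExtension g (ν * (Real.exp (2 * τ) - 1) / 2) (Real.exp τ * y)) t| ≤
          C * Real.exp (-k * |y|))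
    (hν : 0 < ν) (hg : ContDiff ℝ 2 g) (hc : HasCompactSupport g) {δ : ℝ} (hδ : 0 < δ) (T : ℝ) :
    ∃ C' k' : ℝ, 0 < k' ∧ ∀ t ∈ Set.Icc δ T, ∀ y : ℝ,
      |(burgersLayerProfile 1 ν 1 y + sdiff[ν, g, t, y]) ^ 2 - 1 / 4| +
        |deriv (fun s => burgersLayerProfile 1 ν 1 s + sdiff[ν, g, t, s]) y| +
        |deriv (fun s => deriv (fun r => burgersLayerProfile 1 ν 1 r + sdiff[ν, g, t, r]) s) y| +
        |deriv (fun τ => burgersLayerProfile 1 ν 1 y + sdiff[ν, g, τ, y]) t| ≤ C' * Real.exp (-k' * |y|) := by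
  set κ := burgersLayerRate 1 ν with hκdef
  have hκ : 0 < κ := burgersLayerRate_pos one_pos hν
  have h01 : (0:ℝ) ≤ 1 := zero_le_one
  obtain ⟨C, k, hk, hb⟩ := hH δ (max δ T) hδ (le_max_left δ T)
  -- the constants of the Burgers layer
  set A₁ : ℝ := 1 * (1 / Real.sqrt Real.pi * Real.exp (1 / 4)) with hA₁
  set A₂ : ℝ := 1 / Real.sqrt Real.pi * κ * Real.exp (1 / 4) with hA₂
  set A₃ : ℝ := 2 * κ ^ 2 * (1 / Real.sqrt Real.pi) * Real.exp 1 with hA₃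
  refine ⟨A₁ + A₂ + A₃ + max C 0 * (max C 0 + 4), min κ k, lt_min hκ hk, fun t ht y => ?_⟩
  have ht0 : 0 < t := hδ.trans_le ht.1
  have ht' : t ∈ Set.Icc δ (max δ T) := ⟨ht.1, ht.2.trans (le_max_right δ T)⟩
  obtain ⟨b0, b1, b2, b3⟩ := hb t ht' y
  set σ : ℝ := ν * (Real.exp (2 * t) - 1) / 2 with hσ
  -- exponential weights
  set E₁ : ℝ := Real.exp (-κ * |y|) with hE₁
  set E₂ : ℝ := Real.exp (-k * |y|) with hE₂
  set E : ℝ := Real.exp (-min κ k * |y|) with hE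
  have hy : 0 ≤ |y| := abs_nonneg y
  have hE₁E : E₁ ≤ E := Real.exp_le_exp.2 (by nlinarith [min_le_left κ k])
  have hE₂E : E₂ ≤ E := Real.exp_le_exp.2 (by nlinarith [min_le_right κ k])
  have hE₂0 : 0 ≤ E₂ := (Real.exp_pos _).le
  have hE₂1 : E₂ ≤ 1 := Real.exp_le_one_iff.2 (by nlinarith)
  -- upgrade the constant `C` to `max C 0 ≥ 0`
  have hCm : ∀ {a : ℝ}, a ≤ C * E₂ → a ≤ max C 0 * E₂ := fun h =>
    h.trans (mul_le_mul_of_nonneg_right (le_max_left C 0) hE₂0)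
  -- the Burgers layer tails
  have e0 : |burgersLayerProfile 1 ν 1 y| ≤ 1 / 2 := abs_burgersLayerProfile_le one_pos hν h01 y
  have e1 : |burgersLayerProfile 1 ν 1 y ^ 2 - 1 / 4| ≤ A₁ * E₁ := by
    have := abs_burgersLayerProfile_sq_sub_le one_pos hν h01 y
    rwa [one_pow] at this
  have e2 : |burgersLayerProfileD 1 ν 1 y| ≤ A₂ * E₁ := by
    rw [abs_of_nonneg (burgersLayerProfileD_nonneg 1 ν h01 y)]
    exact burgersLayerProfileD_le_exp h01 y
  have e3 : |burgersLayerProfileDD 1 ν 1 y| ≤ A₃ * E₁ := abs_burgersLayerProfileDD_le_exp h01 y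
  -- rewrite the four `P`-quantities in caloric form
  rw [sdiff_eq_heatExtension hν g ht0 y, parallelShearTails_deriv_slice_caloric hν hg hc ht0 y,
    parallelShearTails_deriv_deriv_slice hν hg hc ht0 y, parallelShearTails_deriv_time hν ht0 y]
  exact parallelShearTails_algebra (by positivity) (by positivity) (by positivity) (le_max_right C 0) hE₁E hE₂E
    hE₂0 hE₂1 e0 e1 e2 e3 (hCm b0) (hCm b1) (hCm b2) (hCm b3)

end ParallelShearTails

/-! ### The registered sub-goal -/

/-- **Registered sub-goal `hasShearLayerTails_parallelMember`.** Given the strained-caloric tail estimate (the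
statement of the registered neighbour `stub_strainedCaloricTails`, taken as an explicit hypothesis), for every `ν > 0`
and `g ∈ C²_c(ℝ)` the parallel member `u = U_B^ν(y) + ∫ G₁(z) g(eᵗy − √s(t) z) dz`, `v = 0`, of the crux's class has
SHEAR-LAYER TAILS (`HasShearLayerTails`): clause (i) by the maximum principle for `P`, `P_y` and `|U_B| + |U_B′| ≤ ½ + κ/√π`,
all `x`-derivatives and `v` vanishing; clause (ii) by the hypothesis on `[δ, max δ T]` and the Gaussian tails of the
Burgers layer, with rate `min κ k`. [folklore] -/
theorem hasShearLayerTails_parallelMember :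
    (∀ (ν : ℝ) (g : ℝ → ℝ), 0 < ν → ContDiff ℝ 2 g → HasCompactSupport g → ∀ a b : ℝ, 0 < a → a ≤ b →
      ∃ C k : ℝ, 0 < k ∧ ∀ t ∈ Set.Icc a b, ∀ y : ℝ,
        |heatExtension g (ν * (Real.exp (2 * t) - 1) / 2) (Real.exp t * y)| ≤ C * Real.exp (-k * |y|) ∧
        |deriv (fun s => heatExtension g (ν * (Real.exp (2 * t) - 1) / 2) (Real.exp t * s)) y| ≤
          C * Real.exp (-k * |y|) ∧
        |deriv (fun s => deriv (fun r => heatExtension g (ν * (Real.exp (2 * t) - 1) / 2) (Real.exp t * r)) s) y| ≤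
          C * Real.exp (-k * |y|) ∧
        |deriv (fun τ => heatExtension g (ν * (Real.exp (2 * τ) - 1) / 2) (Real.exp τ * y)) t| ≤
          C * Real.exp (-k * |y|)) →
    ∀ (ν : ℝ) (g : ℝ → ℝ), 0 < ν → ContDiff ℝ 2 g → HasCompactSupport g →
      HasShearLayerTails
        (fun t (_ : ℝ) y => burgersLayerProfile 1 ν 1 y +
          ∫ z, heatKernel 1 z * g (Real.exp t * y - Real.sqrt (ν * (Real.exp (2 * t) - 1) / 2) * z))
        (fun _ _ _ => 0) := by
  intro H1 ν g hν hg hc T _hT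
  set κ := burgersLayerRate 1 ν with hκdef
  have hκ : 0 < κ := burgersLayerRate_pos one_pos hν
  have h01 : (0:ℝ) ≤ 1 := zero_le_one
  obtain ⟨C₀, hC₀, hP⟩ := parallelShearTails_sup hν hg hc T
  refine ⟨⟨1 / 2 + 1 / Real.sqrt Real.pi * κ + (C₀ + C₀), 1, one_pos, fun t ht x y => ⟨?_, ?_⟩⟩,
    fun δ hδ => ?_⟩
  · -- clause (i), bounded quantities
    obtain ⟨h1, h2⟩ := hP t ht y
    have hU : |burgersLayerProfile 1 ν 1 y| ≤ 1 / 2 := abs_burgersLayerProfile_le one_pos hν h01 y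
    have hD : |burgersLayerProfileD 1 ν 1 y| ≤ 1 / Real.sqrt Real.pi * κ := by
      rw [abs_of_nonneg (burgersLayerProfileD_nonneg 1 ν h01 y)]
      exact burgersLayerProfileD_le h01 y
    simp only [dY, deriv_const, abs_zero, add_zero]
    rw [parallelShearTails_deriv_slice hν hg hc ht.1 y]
    have i1 := abs_add_le (burgersLayerProfile 1 ν 1 y) (sdiff[ν, g, t, y])
    have i2 := abs_add_le (burgersLayerProfileD 1 ν 1 y) (deriv (fun s => sdiff[ν, g, t, s]) y)
    linarith
  · -- clause (i), `x`-derivatives vanish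
    have hC : 0 ≤ (1 / 2 + 1 / Real.sqrt Real.pi * κ + (C₀ + C₀)) * Real.exp (-1 * |y|) := by positivity
    simpa [dX] using hC
  · -- clause (ii)
    obtain ⟨C', k', hk', hb⟩ := parallelShearTails_clauseII (H1 ν g hν hg hc) hν hg hc hδ T
    refine ⟨C', k', hk', fun t ht x y => ?_⟩
    have key := hb t ht y
    simp only [dX, dY, deriv_const, abs_zero, add_zero, zero_add, ne_eq, OfNat.ofNat_ne_zero,
      not_false_eq_true, zero_pow]
    linarith [key]

end Summit.AnomalousDissipation.AnomalousDissipation.Theorems.StrainedLayerLaw.LogEnstrophyClock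

end
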